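import Mathlib.Data.Nat.Dist
import Literature.Probability.LatticeModels.TorusBlockKernels
import HarnessLib

/-!
# Block kernels of the cyclic-exponential ("massive") kernel are NOT infinitely divisible

A calibration theorem for conjectures of the type "the `b×b`-BLOCK kernel of a translation-invariant
positive kernel on the discrete torus is infinitely divisible" (route `LevyLogBootstrap` of
`HubbardSuperconductivity`, crux `Block2InfDivXXZ`, where the kernel is the transverse two-point
function of a half-filled XXZ ground state). Take instead the separable, exponentially decaying
kernel
`K(x, y) = λ^{d_M(x₀ - y₀) + d_M(x₁ - y₁)}`, `d_M(u) = min(u.val, M - u.val)` (cyclic distance),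
`0 < λ < 1`, on `(ℤ/Mℤ)²` with `M = b·m`, `b ≥ 2`, `m ≥ 4` even. Its `b`-block coarse kernel
`k_b(X) = Σ_{β x' = X, β y' = 0} K(x', y')` (block membership written exactly as in the route files,
`∀ i, (x' i).val / b = (X i).val`) factorises as `k_b(X) = g(X₀) g(X₁)` with the one-dimensional
block profile `g`, and `g` is EXPLICIT: `g(0) = Σ_{s,t<b} λ^{|s-t|}`, `g(X) = λ^{bX-(b-1)} G'` for
`1 ≤ X ≤ m/2 - 1`, `g(m/2) = λ^{M/2-(b-1)} A₂`, `g(X) = λ^{b(m-X)-(b-1)} G'` for `m/2 < X < m`, where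
`G' = Σ_{s,t<b} λ^{(b-1)+s-t}`, `A₁ = Σ λ^{(b-1)+|s-t|}`, `A₂ = Σ λ^{(b-1)-|s-t|}`, `G' = (A₁ + A₂)/2`.
So `log g` is "affine in the cyclic distance plus two defects", one at the origin (`log(A₁/G')`) and
one at the antipode (`log(A₂/G')`), and the Lévy coefficient at the EVEN axis momentum `q = (2, 0)`
sees only the defects:

* `TorusBlock.expKernel_blockLevyCoeff_eq` —
  `Σ_X log k_b(X) · Re χ_{(2,0)}(X) = m · (log A₁ + log A₂ - 2 log G')`;
* `TorusBlock.expKernel_blockLevyCoeff_neg` — this is `< 0` (strict AM–GM, `A₁ < A₂` for `λ < 1`);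
* `TorusBlock.expKernel_not_isNegDefKernel_negLog_blockKernel` — hence `-log K_b` is NOT a negative
  definite kernel on the fine torus (`TorusBlock.isNegDefKernel_negLog_blockKernel_iff`), i.e. by
  Schoenberg (Berg–Christensen–Ressel Ch. 3 Thm 2.2 / Prop. 2.7) the block kernel `K_b` is not
  infinitely divisible — at EVERY block size `b ≥ 2`, although `K` is entrywise positive, symmetric,
  translation invariant and summable uniformly in `M`.

Reading: block infinite divisibility is not a consequence of positivity + decay; where it holds for
ground-state kernels it reflects slow (order-type) decay. Elementary; sorry-free; no definition is
introduced (the kernel, the profile and the constants are written inline).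
-/

noncomputable section

open Finset Complex
open scoped BigOperators

namespace Literature.Probability.LatticeModels

open Literature.Analysis.Matrix

namespace TorusBlock

/-! ### Reindexing residues in an interval of `ℤ/Mℤ` -/

section Reindex

variable {M : ℕ} [NeZero M]

/-- **Residues in a window are casts of naturals**: for `a + len ≤ M`,
`Σ_{z ∈ ℤ/M, a ≤ z.val < a+len} F(z) = Σ_{s < len} F(↑(a+s))`. [folklore] -/
theorem sum_filter_val_window (a len : ℕ) (h : a + len ≤ M) (F : ZMod M → ℝ) :
    ∑ z ∈ univ.filter (fun z : ZMod M => a ≤ z.val ∧ z.val < a + len), F z =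
      ∑ s : Fin len, F (((a + (s : ℕ) : ℕ)) : ZMod M) := by
  classical
  have hval : ∀ s : Fin len, (((a + (s : ℕ) : ℕ)) : ZMod M).val = a + s := fun s =>
    ZMod.val_cast_of_lt (by have := s.isLt; omega)
  have hinj : ∀ s ∈ (univ : Finset (Fin len)), ∀ s' ∈ (univ : Finset (Fin len)),
      (((a + (s : ℕ) : ℕ)) : ZMod M) = (((a + (s' : ℕ) : ℕ)) : ZMod M) → s = s' := by
    intro s _ s' _ hss'
    have h1 := congrArg ZMod.val hss'
    rw [hval s, hval s'] at h1
    exact Fin.ext (by omega)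
  rw [← Finset.sum_image hinj]
  refine Finset.sum_congr ?_ fun _ _ => rfl
  ext z
  simp only [Finset.mem_filter, Finset.mem_univ, true_and, Finset.mem_image]
  constructor
  · rintro ⟨h1, h2⟩
    refine ⟨⟨z.val - a, by omega⟩, ?_⟩
    have : a + (z.val - a) = z.val := by omega
    simp only [this, ZMod.natCast_zmod_val]
  · rintro ⟨s, rfl⟩
    rw [hval s]
    have := s.isLt
    omega

/-- `z.val / b = c ↔ b·c ≤ z.val < b·c + b` (for `0 < b`). [folklore] -/
theorem nat_div_eq_iff {b : ℕ} (hb : 0 < b) (z c : ℕ) : z / b = c ↔ b * c ≤ z ∧ z < b * c + b := by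
  constructor
  · rintro rfl
    refine ⟨Nat.mul_div_le z b, ?_⟩
    have h1 := Nat.div_add_mod z b
    have h2 := Nat.mod_lt z hb
    omega
  · rintro ⟨h1, h2⟩
    refine Nat.div_eq_of_lt_le ?_ ?_
    · rw [mul_comm]; exact h1
    · rw [Nat.succ_mul, mul_comm]; omega

/-- **A double block sum is a double window sum**: with `M = b·m` and `X ∈ ℤ/m`,
`Σ_{s', t ∈ ℤ/M} [s'.val / b = X.val ∧ t.val / b = 0] f(s', t) = Σ_{s,t<b} f(↑(bX+s), ↑t)`. [folklore] -/
theorem sum_sum_block_eq {b m : ℕ} [NeZero m] (hM : M = b * m) (X : ZMod m)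
    (f : ZMod M → ZMod M → ℝ) :
    (∑ s' : ZMod M, ∑ t : ZMod M,
      if s'.val / b = X.val ∧ t.val / b = 0 then f s' t else 0) =
      ∑ s : Fin b, ∑ t : Fin b, f (((b * X.val + (s : ℕ) : ℕ)) : ZMod M) ((t : ℕ) : ZMod M) := by
  classical
  have hb : 0 < b := pos_of_eq_mul hM
  have hX : X.val < m := ZMod.val_lt X
  have hXM : b * X.val + b ≤ M := by
    rw [hM]
    calc b * X.val + b = b * (X.val + 1) := by ring
      _ ≤ b * m := Nat.mul_le_mul_left b hX
  have hbM : 0 + b ≤ M := by omega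
  -- split the conjunction and pass to filtered sums
  have hsplit : (∑ s' : ZMod M, ∑ t : ZMod M,
      if s'.val / b = X.val ∧ t.val / b = 0 then f s' t else 0) =
      ∑ s' ∈ univ.filter (fun s' : ZMod M => s'.val / b = X.val),
        ∑ t ∈ univ.filter (fun t : ZMod M => t.val / b = 0), f s' t := by
    rw [Finset.sum_filter]
    refine Finset.sum_congr rfl fun s' _ => ?_
    rw [Finset.sum_filter]
    split_ifs with h
    · exact Finset.sum_congr rfl fun t _ => by simp only [h, true_and]
    · exact Finset.sum_eq_zero fun t _ => by simp only [h, false_and, if_false]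
  rw [hsplit]
  have hfilt1 : univ.filter (fun s' : ZMod M => s'.val / b = X.val) =
      univ.filter (fun s' : ZMod M => b * X.val ≤ s'.val ∧ s'.val < b * X.val + b) :=
    Finset.filter_congr fun s' _ => nat_div_eq_iff hb _ _
  have hfilt2 : univ.filter (fun t : ZMod M => t.val / b = 0) =
      univ.filter (fun t : ZMod M => 0 ≤ t.val ∧ t.val < 0 + b) :=
    Finset.filter_congr fun t _ => by rw [nat_div_eq_iff hb, mul_zero, zero_add]
  rw [hfilt1, sum_filter_val_window (b * X.val) b hXM]
  refine Finset.sum_congr rfl fun s _ => ?_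
  rw [hfilt2, sum_filter_val_window 0 b hbM]
  refine Finset.sum_congr rfl fun t _ => ?_
  rw [zero_add]

/-- The value of a difference of two small natural casts in `ℤ/M`. [folklore] -/
theorem val_natCast_sub_natCast {p t : ℕ} (hp : p < M) (ht : t < M) :
    ((p : ZMod M) - (t : ZMod M)).val = if t ≤ p then p - t else M + p - t := by
  split_ifs with h
  · rw [← Nat.cast_sub h, ZMod.val_cast_of_lt (by omega)]
  · push Not at h
    have hne : ((t - p : ℕ) : ZMod M) ≠ 0 := by
      intro h0
      have := congrArg ZMod.val h0
      rw [ZMod.val_cast_of_lt (by omega), ZMod.val_zero] at this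
      omega
    rw [show (p : ZMod M) - (t : ZMod M) = -((t : ZMod M) - (p : ZMod M)) by ring,
      ← Nat.cast_sub h.le, ZMod.neg_val, if_neg hne, ZMod.val_cast_of_lt (by omega)]
    omega

end Reindex

/-! ### The one-dimensional block profile of the cyclic-exponential kernel -/

section Profile

variable {b m M : ℕ} [NeZero M] [NeZero m]

/-- **The block profile at the origin**: `g(0) = Σ_{s,t<b} λ^{|s-t|}`. [folklore] -/
theorem expProfile_zero (hM : M = b * m) (hm : 2 ≤ m) (lam : ℝ) :
    (∑ s' : ZMod M, ∑ t : ZMod M,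
      if s'.val / b = (0 : ZMod m).val ∧ t.val / b = 0 then
        lam ^ min (s' - t).val (M - (s' - t).val) else 0) =
      ∑ s : Fin b, ∑ t : Fin b, lam ^ Nat.dist s t := by
  rw [sum_sum_block_eq hM 0 (fun s' t => lam ^ min (s' - t).val (M - (s' - t).val))]
  have hb : 0 < b := pos_of_eq_mul hM
  have h2b : 2 * b ≤ M := by
    rw [hM, mul_comm 2 b]
    exact Nat.mul_le_mul_left b hm
  refine Finset.sum_congr rfl fun s _ => Finset.sum_congr rfl fun t _ => ?_
  have hs := s.isLt
  have ht := t.isLt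
  rw [ZMod.val_zero, mul_zero, zero_add,
    val_natCast_sub_natCast (M := M) (by omega) (by omega)]
  congr 1
  simp only [Nat.dist]
  split_ifs with h
  · rw [Nat.min_def]; split_ifs <;> omega
  · rw [Nat.min_def]; split_ifs <;> omega

/-- **The block profile near the origin**: for `1 ≤ X.val ≤ m/2 - 1`,
`g(X) = λ^{bX - (b-1)} · Σ_{s,t<b} λ^{(b-1)+s-t}`. [folklore] -/
theorem expProfile_near (hM : M = b * m) {k : ℕ} (hk : m = k + k) (lam : ℝ) (X : ZMod m)
    (h1 : 1 ≤ X.val) (h2 : X.val + 1 ≤ k) :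
    (∑ s' : ZMod M, ∑ t : ZMod M,
      if s'.val / b = X.val ∧ t.val / b = 0 then
        lam ^ min (s' - t).val (M - (s' - t).val) else 0) =
      lam ^ (b * X.val - (b - 1)) * ∑ s : Fin b, ∑ t : Fin b, lam ^ (b - 1 + s - t) := by
  rw [sum_sum_block_eq hM X (fun s' t => lam ^ min (s' - t).val (M - (s' - t).val)), Finset.mul_sum]
  have hb : 0 < b := pos_of_eq_mul hM
  -- atomise the products
  set P := b * X.val with hP
  set Q := b * k with hQ
  have hMQ : M = Q + Q := by rw [hM, hk, hQ]; ring
  have hPb : b ≤ P := by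
    calc b = b * 1 := (mul_one b).symm
      _ ≤ b * X.val := Nat.mul_le_mul_left b h1
  have hPQ : P + b ≤ Q := by
    calc P + b = b * (X.val + 1) := by rw [hP]; ring
      _ ≤ b * k := Nat.mul_le_mul_left b h2
  refine Finset.sum_congr rfl fun s _ => ?_
  rw [Finset.mul_sum]
  refine Finset.sum_congr rfl fun t _ => ?_
  have hs := s.isLt
  have ht := t.isLt
  rw [val_natCast_sub_natCast (M := M) (by omega) (by omega), if_pos (by omega), ← pow_add]
  congr 1
  rw [Nat.min_def]
  split_ifs <;> omega

/-- **The block profile at the antipode**: `g(m/2) = λ^{M/2 - (b-1)} · Σ_{s,t<b} λ^{(b-1)-|s-t|}`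
(`m = 2k`, `k ≥ 1`, `b ≥ 1`; `M/2 = bk`). [folklore] -/
theorem expProfile_half (hM : M = b * m) {k : ℕ} (hk : m = k + k) (hk1 : 1 ≤ k) (lam : ℝ) :
    (∑ s' : ZMod M, ∑ t : ZMod M,
      if s'.val / b = ((k : ℕ) : ZMod m).val ∧ t.val / b = 0 then
        lam ^ min (s' - t).val (M - (s' - t).val) else 0) =
      lam ^ (b * k - (b - 1)) * ∑ s : Fin b, ∑ t : Fin b, lam ^ (b - 1 - Nat.dist s t) := by
  rw [sum_sum_block_eq hM _ (fun s' t => lam ^ min (s' - t).val (M - (s' - t).val)), Finset.mul_sum]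
  have hb : 0 < b := pos_of_eq_mul hM
  have hval : ((k : ℕ) : ZMod m).val = k := ZMod.val_cast_of_lt (by omega)
  set Q := b * k with hQ
  have hMQ : M = Q + Q := by rw [hM, hk, hQ]; ring
  have hQb : b ≤ Q := by
    calc b = b * 1 := (mul_one b).symm
      _ ≤ b * k := Nat.mul_le_mul_left b hk1
  rw [hval]
  refine Finset.sum_congr rfl fun s _ => ?_
  rw [Finset.mul_sum]
  refine Finset.sum_congr rfl fun t _ => ?_
  have hs := s.isLt
  have ht := t.isLt
  rw [val_natCast_sub_natCast (M := M) (by omega) (by omega), if_pos (by omega), ← pow_add]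
  congr 1
  simp only [Nat.dist]
  rw [Nat.min_def]
  split_ifs <;> omega

/-- **The block profile beyond the antipode**: for `m/2 + 1 ≤ X.val` (`< m`),
`g(X) = λ^{b(m-X) - (b-1)} · Σ_{s,t<b} λ^{(b-1)+s-t}`. [folklore] -/
theorem expProfile_far (hM : M = b * m) {k : ℕ} (hk : m = k + k) (lam : ℝ) (X : ZMod m)
    (h1 : k + 1 ≤ X.val) :
    (∑ s' : ZMod M, ∑ t : ZMod M,
      if s'.val / b = X.val ∧ t.val / b = 0 then
        lam ^ min (s' - t).val (M - (s' - t).val) else 0) =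
      lam ^ (b * (m - X.val) - (b - 1)) * ∑ s : Fin b, ∑ t : Fin b, lam ^ (b - 1 + s - t) := by
  rw [sum_sum_block_eq hM X (fun s' t => lam ^ min (s' - t).val (M - (s' - t).val)), Finset.mul_sum]
  have hb : 0 < b := pos_of_eq_mul hM
  have hX : X.val < m := ZMod.val_lt X
  set P := b * X.val with hP
  set Q := b * k with hQ
  set R := b * (m - X.val) with hR
  have hMQ : M = Q + Q := by rw [hM, hk, hQ]; ring
  have hPR : P + R = M := by
    rw [hP, hR, hM, ← Nat.mul_add]
    congr 1
    omega
  have hRb : b ≤ R := by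
    calc b = b * 1 := (mul_one b).symm
      _ ≤ b * (m - X.val) := Nat.mul_le_mul_left b (by omega)
  have hQP : Q + b ≤ P := by
    calc Q + b = b * (k + 1) := by rw [hQ]; ring
      _ ≤ b * X.val := Nat.mul_le_mul_left b (by omega)
  have hPM : P + b ≤ M := by
    calc P + b = b * (X.val + 1) := by rw [hP]; ring
      _ ≤ b * m := Nat.mul_le_mul_left b hX
      _ = M := hM.symm
  -- swap `s ↔ t` on the right so that both sides run over the same exponent
  rw [Finset.sum_comm]
  refine Finset.sum_congr rfl fun s _ => ?_
  rw [Finset.mul_sum]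
  refine Finset.sum_congr rfl fun t _ => ?_
  have hs := s.isLt
  have ht := t.isLt
  rw [val_natCast_sub_natCast (M := M) (by omega) (by omega), if_pos (by omega), ← pow_add]
  congr 1
  rw [Nat.min_def]
  split_ifs <;> omega

end Profile

/-! ### The one-dimensional Lévy sum: only the two defects survive an even momentum -/

section Fourier

variable {b m M : ℕ} [NeZero M] [NeZero m]

/-- **Half-ring split**: for `m = k + k`, `Σ_{X ∈ ℤ/m} F(X) = Σ_{s<k} F(↑s) + Σ_{s<k} F(↑(k+s))`.
[folklore] -/
theorem sum_zmod_eq_sum_half_add {k : ℕ} (hk : m = k + k) (F : ZMod m → ℝ) :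
    ∑ X : ZMod m, F X =
      ∑ s : Fin k, F ((s : ℕ) : ZMod m) + ∑ s : Fin k, F (((k + (s : ℕ) : ℕ)) : ZMod m) := by
  classical
  rw [← Finset.sum_filter_add_sum_filter_not univ (fun X : ZMod m => X.val < k)]
  have hf1 : univ.filter (fun X : ZMod m => X.val < k) =
      univ.filter (fun X : ZMod m => 0 ≤ X.val ∧ X.val < 0 + k) :=
    Finset.filter_congr fun X _ => by simp
  have hf2 : univ.filter (fun X : ZMod m => ¬ X.val < k) =
      univ.filter (fun X : ZMod m => k ≤ X.val ∧ X.val < k + k) :=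
    Finset.filter_congr fun X _ => by
      have := ZMod.val_lt X
      constructor
      · intro h; exact ⟨not_lt.mp h, by omega⟩
      · intro h; exact not_lt.mpr h.1
  rw [hf1, hf2, sum_filter_val_window 0 k (by omega), sum_filter_val_window k k (by omega)]
  simp only [zero_add]

/-- **The one-dimensional Lévy sum of the block profile against a half-periodic, mean-zero weight.**
For `M = b·m`, `m = 2k`, `k ≥ 2`, `b ≥ 1`, `0 < λ`, and a weight `c : ℤ/m → ℝ` with `c(X + k) = c(X)`,
`Σ c = 0`, `c(0) = 1` (e.g. `c = Re e(2X/m)`):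
`Σ_X log g(X) · c(X) = log(λ^{b-1} Σ λ^{|s-t|}) + log(Σ λ^{(b-1)-|s-t|}) - 2 log(Σ λ^{(b-1)+s-t})`,
`g` the block profile of the cyclic-exponential kernel (given through its defining equation `hgdef`).
The affine part of `log g` pairs off
(`X ↔ X + k`), only the defects at `0` and `k` remain. [folklore] -/
theorem sum_log_expProfile_mul (hM : M = b * m) {k : ℕ} (hk : m = k + k) (hk2 : 2 ≤ k)
    {lam : ℝ} (hlam : 0 < lam) (g : ZMod m → ℝ)
    (hgdef : ∀ X : ZMod m, g X = ∑ s' : ZMod M, ∑ t : ZMod M,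
        if s'.val / b = X.val ∧ t.val / b = 0 then
          lam ^ min (s' - t).val (M - (s' - t).val) else 0)
    (c : ZMod m → ℝ)
    (hhalf : ∀ X : ZMod m, c (X + ((k : ℕ) : ZMod m)) = c X) (hsum : ∑ X : ZMod m, c X = 0)
    (hc0 : c 0 = 1) :
    ∑ X : ZMod m, Real.log (g X) * c X =
      Real.log (lam ^ (b - 1) * ∑ s : Fin b, ∑ t : Fin b, lam ^ Nat.dist s t) +
        Real.log (∑ s : Fin b, ∑ t : Fin b, lam ^ (b - 1 - Nat.dist s t)) -
        2 * Real.log (∑ s : Fin b, ∑ t : Fin b, lam ^ (b - 1 + s - t)) := by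
  classical
  have hb : 0 < b := pos_of_eq_mul hM
  set C : ℝ := ∑ s : Fin b, ∑ t : Fin b, lam ^ Nat.dist s t with hC
  set A₂ : ℝ := ∑ s : Fin b, ∑ t : Fin b, lam ^ (b - 1 - Nat.dist s t) with hA₂
  set G : ℝ := ∑ s : Fin b, ∑ t : Fin b, lam ^ (b - 1 + s - t) with hG
  have hne : (univ : Finset (Fin b)).Nonempty := ⟨⟨0, hb⟩, mem_univ _⟩
  have hCpos : 0 < C := Finset.sum_pos (fun s _ => Finset.sum_pos (fun t _ => pow_pos hlam _) hne) hne
  have hA₂pos : 0 < A₂ := Finset.sum_pos (fun s _ => Finset.sum_pos (fun t _ => pow_pos hlam _) hne) hne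
  have hGpos : 0 < G := Finset.sum_pos (fun s _ => Finset.sum_pos (fun t _ => pow_pos hlam _) hne) hne
  -- casts
  have hvalk : ((k : ℕ) : ZMod m).val = k := ZMod.val_cast_of_lt (by omega)
  have hvals : ∀ s : Fin k, ((s : ℕ) : ZMod m).val = s := fun s =>
    ZMod.val_cast_of_lt (by have := s.isLt; omega)
  have hvalks : ∀ s : Fin k, (((k + (s : ℕ) : ℕ)) : ZMod m).val = k + s := fun s =>
    ZMod.val_cast_of_lt (by have := s.isLt; omega)
  have hcast : ∀ s : Fin k, (((k + (s : ℕ) : ℕ)) : ZMod m) = ((s : ℕ) : ZMod m) + ((k : ℕ) : ZMod m) :=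
    fun s => by push_cast; ring
  -- the four values of `g`
  have hg0 : g 0 = C := by
    rw [hgdef, hC]
    exact expProfile_zero hM (by omega) lam
  have hgk : g ((k : ℕ) : ZMod m) = lam ^ (b * k - (b - 1)) * A₂ := by
    rw [hgdef, hA₂]
    exact expProfile_half hM hk (by omega) lam
  have hgnear : ∀ s : Fin k, 1 ≤ (s : ℕ) →
      g ((s : ℕ) : ZMod m) = lam ^ (b * s - (b - 1)) * G := by
    intro s hs1
    have hs := s.isLt
    have h := expProfile_near hM hk lam ((s : ℕ) : ZMod m) (by rw [hvals s]; exact hs1)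
      (by rw [hvals s]; omega)
    rw [hgdef]
    simpa only [hG, hvals s] using h
  have hgfar : ∀ s : Fin k, 1 ≤ (s : ℕ) →
      g (((k + (s : ℕ) : ℕ)) : ZMod m) = lam ^ (b * (k - s) - (b - 1)) * G := by
    intro s hs1
    have hs := s.isLt
    have h := expProfile_far hM hk lam (((k + (s : ℕ) : ℕ)) : ZMod m) (by rw [hvalks s]; omega)
    have hks : m - (k + s) = k - s := by omega
    rw [hgdef]
    simpa only [hG, hvalks s, hks] using h
  -- the paired logarithms are constant off the origin
  have hpair : ∀ s : Fin k, 1 ≤ (s : ℕ) →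
      Real.log (g ((s : ℕ) : ZMod m)) + Real.log (g (((k + (s : ℕ) : ℕ)) : ZMod m)) =
        ((b * k - 2 * (b - 1) : ℕ) : ℝ) * Real.log lam + 2 * Real.log G := by
    intro s hs1
    have hs := s.isLt
    rw [hgnear s hs1, hgfar s hs1, Real.log_mul (pow_pos hlam _).ne' hGpos.ne',
      Real.log_mul (pow_pos hlam _).ne' hGpos.ne', Real.log_pow, Real.log_pow]
    have hexp : (b * s - (b - 1)) + (b * (k - s) - (b - 1)) = b * k - 2 * (b - 1) := by
      have h1 : b ≤ b * s := by
        calc b = b * 1 := (mul_one b).symm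
          _ ≤ b * s := Nat.mul_le_mul_left b hs1
      have h2 : b ≤ b * (k - s) := by
        calc b = b * 1 := (mul_one b).symm
          _ ≤ b * (k - s) := Nat.mul_le_mul_left b (by omega)
      have h3 : b * s + b * (k - s) = b * k := by
        rw [← Nat.mul_add]; congr 1; omega
      omega
    have hexp' : ((b * s - (b - 1) : ℕ) : ℝ) + ((b * (k - s) - (b - 1) : ℕ) : ℝ) =
        ((b * k - 2 * (b - 1) : ℕ) : ℝ) := by exact_mod_cast hexp
    rw [← hexp']
    ring
  -- split the sum over the two half rings and pair
  have hc2 : ∀ s : Fin k, c (((k + (s : ℕ) : ℕ)) : ZMod m) = c ((s : ℕ) : ZMod m) := fun s => by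
    rw [hcast s, hhalf]
  have hsplit : ∑ X : ZMod m, Real.log (g X) * c X =
      ∑ s : Fin k, (Real.log (g ((s : ℕ) : ZMod m)) +
        Real.log (g (((k + (s : ℕ) : ℕ)) : ZMod m))) * c ((s : ℕ) : ZMod m) := by
    rw [sum_zmod_eq_sum_half_add hk (fun X => Real.log (g X) * c X), ← Finset.sum_add_distrib]
    refine Finset.sum_congr rfl fun s _ => ?_
    rw [hc2 s]
    ring
  rw [hsplit]
  -- the weight has mean zero on the half ring
  have hc_half_sum : ∑ s : Fin k, c ((s : ℕ) : ZMod m) = 0 := by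
    have h := sum_zmod_eq_sum_half_add hk c
    simp only [hc2] at h
    linarith
  -- peel off `s = 0`
  obtain ⟨k', rfl⟩ : ∃ k', k = k' + 1 := ⟨k - 1, by omega⟩
  rw [Fin.sum_univ_succ]
  rw [Fin.sum_univ_succ] at hc_half_sum
  have hsucc : ∀ s : Fin k', Real.log (g (((s.succ : Fin (k' + 1)) : ℕ) : ZMod m)) +
      Real.log (g (((k' + 1 + ((s.succ : Fin (k' + 1)) : ℕ) : ℕ)) : ZMod m)) =
      ((b * (k' + 1) - 2 * (b - 1) : ℕ) : ℝ) * Real.log lam + 2 * Real.log G :=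
    fun s => hpair s.succ (by simp)
  simp only [hsucc]
  rw [← Finset.mul_sum]
  have h0 : (((0 : Fin (k' + 1)) : ℕ) : ZMod m) = 0 := by simp
  rw [h0] at hc_half_sum ⊢
  rw [hc0] at hc_half_sum ⊢
  have hrest : ∑ s : Fin k', c ((((s.succ : Fin (k' + 1)) : ℕ)) : ZMod m) = -1 := by linarith
  have hk0 : (((k' + 1 + ((0 : Fin (k' + 1)) : ℕ) : ℕ)) : ZMod m) = ((k' + 1 : ℕ) : ZMod m) := by
    simp
  rw [hrest, hg0, hk0, hgk, Real.log_mul (pow_pos hlam _).ne' hA₂pos.ne', Real.log_pow,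
    Real.log_mul (pow_pos hlam _).ne' hCpos.ne', Real.log_pow]
  have hexp : (b * (k' + 1) - (b - 1) : ℕ) = (b * (k' + 1) - 2 * (b - 1)) + (b - 1) := by
    have h1 : 2 * b ≤ b * (k' + 1) := by
      rw [mul_comm 2 b]; exact Nat.mul_le_mul_left b (by omega)
    omega
  have hexp' : ((b * (k' + 1) - (b - 1) : ℕ) : ℝ) =
      ((b * (k' + 1) - 2 * (b - 1) : ℕ) : ℝ) + ((b - 1 : ℕ) : ℝ) := by exact_mod_cast hexp
  rw [hexp']
  ring

/-- **Strict AM–GM for the two defect constants.** For `0 < λ < 1` and `b ≥ 2`, with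
`A₁ = Σ_{s,t<b} λ^{(b-1)+|s-t|}`, `A₂ = Σ λ^{(b-1)-|s-t|}`, `G' = Σ λ^{(b-1)+s-t}`:
`G' + G' = A₁ + A₂`, `A₁ < A₂`, hence `log A₁ + log A₂ < 2 log G'`. [folklore] -/
theorem log_defects_lt {b : ℕ} (hb : 2 ≤ b) {lam : ℝ} (hlam : 0 < lam) (hlam1 : lam < 1) :
    Real.log (lam ^ (b - 1) * ∑ s : Fin b, ∑ t : Fin b, lam ^ Nat.dist s t) +
        Real.log (∑ s : Fin b, ∑ t : Fin b, lam ^ (b - 1 - Nat.dist s t)) <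
      2 * Real.log (∑ s : Fin b, ∑ t : Fin b, lam ^ (b - 1 + s - t)) := by
  set A₁ : ℝ := ∑ s : Fin b, ∑ t : Fin b, lam ^ (b - 1 + Nat.dist s t) with hA₁
  set A₂ : ℝ := ∑ s : Fin b, ∑ t : Fin b, lam ^ (b - 1 - Nat.dist s t) with hA₂
  set G : ℝ := ∑ s : Fin b, ∑ t : Fin b, lam ^ (b - 1 + s - t) with hG
  have hne : (univ : Finset (Fin b)).Nonempty := ⟨⟨0, by omega⟩, mem_univ _⟩
  have hA₁eq : lam ^ (b - 1) * ∑ s : Fin b, ∑ t : Fin b, lam ^ Nat.dist s t = A₁ := by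
    rw [hA₁, Finset.mul_sum]
    refine Finset.sum_congr rfl fun s _ => ?_
    rw [Finset.mul_sum]
    refine Finset.sum_congr rfl fun t _ => ?_
    rw [← pow_add]
  rw [hA₁eq]
  have hA₁pos : 0 < A₁ := Finset.sum_pos (fun s _ => Finset.sum_pos (fun t _ => pow_pos hlam _) hne) hne
  have hGpos : 0 < G := Finset.sum_pos (fun s _ => Finset.sum_pos (fun t _ => pow_pos hlam _) hne) hne
  -- `2 G' = A₁ + A₂`
  have hGG : G + G = A₁ + A₂ := by
    have hG' : G = ∑ s : Fin b, ∑ t : Fin b, lam ^ (b - 1 + t - s) := by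
      rw [hG, Finset.sum_comm]
    conv_lhs => arg 2; rw [hG']
    rw [hG, hA₁, hA₂, ← Finset.sum_add_distrib, ← Finset.sum_add_distrib]
    refine Finset.sum_congr rfl fun s _ => ?_
    rw [← Finset.sum_add_distrib, ← Finset.sum_add_distrib]
    refine Finset.sum_congr rfl fun t _ => ?_
    have hs := s.isLt
    have ht := t.isLt
    simp only [Nat.dist]
    rcases le_or_gt (t : ℕ) s with h | h
    · have e1 : b - 1 + (t : ℕ) - s = b - 1 - ((s : ℕ) - t + (t - s)) := by omega
      have e2 : b - 1 + (s : ℕ) - t = b - 1 + ((s : ℕ) - t + (t - s)) := by omega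
      rw [e1, e2]
    · have e1 : b - 1 + (t : ℕ) - s = b - 1 + ((s : ℕ) - t + (t - s)) := by omega
      have e2 : b - 1 + (s : ℕ) - t = b - 1 - ((s : ℕ) - t + (t - s)) := by omega
      rw [e1, e2, add_comm]
  -- `A₁ < A₂`
  have hA₁A₂ : A₁ < A₂ := by
    rw [hA₁, hA₂]
    have hle : ∀ s t : Fin b, lam ^ (b - 1 + Nat.dist s t) ≤ lam ^ (b - 1 - Nat.dist s t) :=
      fun s t => pow_le_pow_of_le_one hlam.le hlam1.le (by omega)
    refine Finset.sum_lt_sum (fun s _ => Finset.sum_le_sum fun t _ => hle s t)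
      ⟨⟨0, by omega⟩, mem_univ _, ?_⟩
    refine Finset.sum_lt_sum (fun t _ => hle _ t) ⟨⟨1, by omega⟩, mem_univ _, ?_⟩
    refine pow_lt_pow_right_of_lt_one₀ hlam hlam1 ?_
    simp only [Nat.dist]
    omega
  -- conclude
  have hprod : A₁ * A₂ < G ^ 2 := by nlinarith [hGG, hA₁A₂]
  have hlog := Real.log_lt_log (mul_pos hA₁pos (hA₁pos.trans hA₁A₂)) hprod
  rw [Real.log_mul hA₁pos.ne' (hA₁pos.trans hA₁A₂).ne', Real.log_pow] at hlog
  simpa using hlog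

end Fourier

/-! ### The planar kernel: factorisation, the Lévy coefficient at `q = (2,0)`, non-divisibility -/

section Planar

variable {b m M : ℕ} [NeZero M] [NeZero m]

/-- **The cyclic distance is even**: `d_M(-u) = d_M(u)`. [folklore] -/
theorem cyclicDist_neg (u : ZMod M) : min (-u).val (M - (-u).val) = min u.val (M - u.val) := by
  rcases eq_or_ne u 0 with rfl | h
  · simp
  · rw [ZMod.neg_val, if_neg h, Nat.sub_sub_self (ZMod.val_lt u).le, min_comm]

omit [NeZero m] in
/-- **Block sums of a separable kernel factorise**: for the kernel
`K(x, y) = λ^{Σᵢ d_M(xᵢ - yᵢ)} = ∏ᵢ λ^{d_M(xᵢ - yᵢ)}` on `(ℤ/M)^d`, the coarse `b`-block kernel is the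
product of the one-dimensional block profiles: `k_b(X) = ∏ᵢ g(Xᵢ)`. [folklore] -/
theorem expKernel_coarse_eq_prod {d : ℕ} (lam : ℝ) (X : TorusSite d m) :
    (∑ x' : TorusSite d M, ∑ y' : TorusSite d M,
      if (∀ i : Fin d, (x' i).val / b = (X i).val) ∧ (∀ i : Fin d, (y' i).val / b = 0) then
        lam ^ (∑ i : Fin d, min (x' i - y' i).val (M - (x' i - y' i).val)) else 0) =
      ∏ i : Fin d, (∑ s' : ZMod M, ∑ t : ZMod M,
        if s'.val / b = (X i).val ∧ t.val / b = 0 then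
          lam ^ min (s' - t).val (M - (s' - t).val) else 0) := by
  classical
  symm
  rw [Fintype.prod_sum]
  refine Finset.sum_congr rfl fun x' _ => ?_
  rw [Fintype.prod_sum]
  refine Finset.sum_congr rfl fun y' _ => ?_
  by_cases h : (∀ i : Fin d, (x' i).val / b = (X i).val) ∧ (∀ i : Fin d, (y' i).val / b = 0)
  · rw [if_pos h, ← Finset.prod_pow_eq_pow_sum]
    exact Finset.prod_congr rfl fun i _ => if_pos ⟨h.1 i, h.2 i⟩
  · rw [if_neg h]
    have hex : ∃ i : Fin d, ¬ ((x' i).val / b = (X i).val ∧ (y' i).val / b = 0) := by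
      by_contra hcon
      push Not at hcon
      exact h ⟨fun i => (hcon i).1, fun i => (hcon i).2⟩
    obtain ⟨i, hi⟩ := hex
    exact Finset.prod_eq_zero (Finset.mem_univ i) (if_neg hi)

/-- **The block Lévy coefficient of the cyclic-exponential kernel at the even axis momentum
`q = (2, 0)` — exact value.** For `M = b·m`, `m = 2k`, `k ≥ 2`, `b ≥ 1`, `0 < λ`, with block
membership written as in `TorusBlock.isNegDefKernel_negLog_blockKernel_iff`:
`Σ_X log k_b(X) · Re χ_{(2,0)}(X) = m · (log(λ^{b-1} Σ λ^{|s-t|}) + log(Σ λ^{(b-1)-|s-t|}) - 2 log(Σ λ^{(b-1)+s-t}))`.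
[folklore] -/
theorem expKernel_blockLevyCoeff_eq (hM : M = b * m) {k : ℕ} (hk : m = k + k) (hk2 : 2 ≤ k)
    {lam : ℝ} (hlam : 0 < lam) :
    ∑ X : TorusSite 2 m, Real.log (∑ x' : TorusSite 2 M, ∑ y' : TorusSite 2 M,
        if (∀ i : Fin 2, (x' i).val / b = (X i).val) ∧ (∀ i : Fin 2, (y' i).val / b = 0) then
          lam ^ (∑ i : Fin 2, min (x' i - y' i).val (M - (x' i - y' i).val)) else 0) *
        (torusChar (Pi.single 0 (2 : ZMod m)) X).re =
      (m : ℝ) * (Real.log (lam ^ (b - 1) * ∑ s : Fin b, ∑ t : Fin b, lam ^ Nat.dist s t) +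
        Real.log (∑ s : Fin b, ∑ t : Fin b, lam ^ (b - 1 - Nat.dist s t)) -
        2 * Real.log (∑ s : Fin b, ∑ t : Fin b, lam ^ (b - 1 + s - t))) := by
  classical
  have hb : 0 < b := pos_of_eq_mul hM
  have hne : (univ : Finset (Fin b)).Nonempty := ⟨⟨0, hb⟩, mem_univ _⟩
  -- the one-dimensional profile and the weight
  set g : ZMod m → ℝ := fun Y => ∑ s' : ZMod M, ∑ t : ZMod M,
      if s'.val / b = Y.val ∧ t.val / b = 0 then
        lam ^ min (s' - t).val (M - (s' - t).val) else 0 with hg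
  have hgdef : ∀ Y : ZMod m, g Y = ∑ s' : ZMod M, ∑ t : ZMod M,
      if s'.val / b = Y.val ∧ t.val / b = 0 then
        lam ^ min (s' - t).val (M - (s' - t).val) else 0 := fun Y => by rw [hg]
  have hgpos : ∀ Y, 0 < g Y := fun Y => by
    rw [hgdef, sum_sum_block_eq hM Y (fun s' t => lam ^ min (s' - t).val (M - (s' - t).val))]
    exact Finset.sum_pos (fun s _ => Finset.sum_pos (fun t _ => pow_pos hlam _) hne) hne
  set c : ZMod m → ℝ := fun Y => ((ZMod.stdAddChar (Y * 2) : ℂ)).re with hc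
  have hchar : ∀ X : TorusSite 2 m, (torusChar (Pi.single 0 (2 : ZMod m)) X).re = c (X 0) :=
    fun X => by rw [torusChar_comm, torusChar_axisPoint]
  have hk2' : ((k : ℕ) : ZMod m) * 2 = 0 := by
    rw [show ((k : ℕ) : ZMod m) * 2 = ((k * 2 : ℕ) : ZMod m) by push_cast; ring,
      show k * 2 = m by omega, ZMod.natCast_self]
  have hhalf : ∀ Y, c (Y + ((k : ℕ) : ZMod m)) = c Y := fun Y => by
    simp only [hc]
    rw [add_mul, AddChar.map_add_eq_mul, hk2', AddChar.map_zero_eq_one, mul_one]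
  have h2ne : (2 : ZMod m) ≠ 0 := by
    intro h
    have h' : ((2 : ℕ) : ZMod m) = 0 := by exact_mod_cast h
    rw [ZMod.natCast_eq_zero_iff] at h'
    have := Nat.le_of_dvd (by norm_num) h'
    omega
  have hsum : ∑ Y, c Y = 0 := by
    simp only [hc]
    rw [← Complex.re_sum, AddChar.sum_mulShift _ (ZMod.isPrimitive_stdAddChar m), if_neg h2ne]
    simp
  have hc0 : c 0 = 1 := by simp [hc]
  -- the one-dimensional identity
  have h1D := sum_log_expProfile_mul hM hk hk2 hlam g hgdef c hhalf hsum hc0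
  -- factorise the block kernel and the character
  have hfac : ∀ X : TorusSite 2 m, (∑ x' : TorusSite 2 M, ∑ y' : TorusSite 2 M,
      if (∀ i : Fin 2, (x' i).val / b = (X i).val) ∧ (∀ i : Fin 2, (y' i).val / b = 0) then
        lam ^ (∑ i : Fin 2, min (x' i - y' i).val (M - (x' i - y' i).val)) else 0) =
      g (X 0) * g (X 1) := fun X => by
    rw [expKernel_coarse_eq_prod, Fin.prod_univ_two, hgdef, hgdef]
  have hterm : ∀ X : TorusSite 2 m, Real.log (∑ x' : TorusSite 2 M, ∑ y' : TorusSite 2 M,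
      if (∀ i : Fin 2, (x' i).val / b = (X i).val) ∧ (∀ i : Fin 2, (y' i).val / b = 0) then
        lam ^ (∑ i : Fin 2, min (x' i - y' i).val (M - (x' i - y' i).val)) else 0) *
        (torusChar (Pi.single 0 (2 : ZMod m)) X).re =
      (Real.log (g (X 0)) + Real.log (g (X 1))) * c (X 0) := fun X => by
    rw [hfac, hchar, Real.log_mul (hgpos _).ne' (hgpos _).ne']
  rw [Finset.sum_congr rfl fun X _ => hterm X]
  -- pass to a double sum over `ℤ/m × ℤ/m`
  rw [Fintype.sum_equiv (piFinTwoEquiv fun _ => ZMod m)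
      (fun X : TorusSite 2 m => (Real.log (g (X 0)) + Real.log (g (X 1))) * c (X 0))
      (fun p : ZMod m × ZMod m => (Real.log (g p.1) + Real.log (g p.2)) * c p.1) (fun X => rfl),
    Fintype.sum_prod_type]
  simp only
  have hinner : ∀ Y : ZMod m, ∑ Z : ZMod m, (Real.log (g Y) + Real.log (g Z)) * c Y =
      (m : ℝ) * (Real.log (g Y) * c Y) + c Y * ∑ Z : ZMod m, Real.log (g Z) := by
    intro Y
    have : ∀ Z : ZMod m, (Real.log (g Y) + Real.log (g Z)) * c Y =
        Real.log (g Y) * c Y + c Y * Real.log (g Z) := fun Z => by ring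
    simp only [this]
    rw [Finset.sum_add_distrib, Finset.sum_const, Finset.card_univ, ZMod.card, nsmul_eq_mul,
      ← Finset.mul_sum]
  simp only [hinner]
  rw [Finset.sum_add_distrib, ← Finset.mul_sum, ← Finset.sum_mul, hsum, zero_mul, add_zero, h1D]

/-- **The block Lévy coefficient of the cyclic-exponential kernel at `q = (2, 0)` is NEGATIVE**
for every `0 < λ < 1`, every block size `b ≥ 2` and every even coarse size `m ≥ 4`. [folklore] -/
theorem expKernel_blockLevyCoeff_neg (hM : M = b * m) (hb : 2 ≤ b) {k : ℕ} (hk : m = k + k)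
    (hk2 : 2 ≤ k) {lam : ℝ} (hlam : 0 < lam) (hlam1 : lam < 1) :
    ∑ X : TorusSite 2 m, Real.log (∑ x' : TorusSite 2 M, ∑ y' : TorusSite 2 M,
        if (∀ i : Fin 2, (x' i).val / b = (X i).val) ∧ (∀ i : Fin 2, (y' i).val / b = 0) then
          lam ^ (∑ i : Fin 2, min (x' i - y' i).val (M - (x' i - y' i).val)) else 0) *
        (torusChar (Pi.single 0 (2 : ZMod m)) X).re < 0 := by
  rw [expKernel_blockLevyCoeff_eq hM hk hk2 hlam]
  have hm : (0 : ℝ) < m := by exact_mod_cast (show 0 < m by omega)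
  have h := log_defects_lt hb hlam hlam1
  nlinarith

/-- **The block kernel of the cyclic-exponential kernel is not of negative log-type.**
For `M = b·m`, `b ≥ 2`, `m ≥ 4` even and `0 < λ < 1`, the `b`-block kernel `K_b` of
`K(x, y) = λ^{d_M(x₀-y₀) + d_M(x₁-y₁)}` on `(ℤ/Mℤ)²` has `-log K_b` NOT negative definite — although
`K` is entrywise positive, symmetric and translation invariant. By Schoenberg's theorem
(`-log φ` negative definite ⇔ all Hadamard powers `φ^t` positive definite, Berg–Christensen–Ressel
1984, Ch. 3 Thm 2.2 / Prop. 2.7) `K_b` is not infinitely divisible: block infinite divisibility is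
not a consequence of positivity and (fast) decay. [folklore] -/
theorem expKernel_not_isNegDefKernel_negLog_blockKernel (hM : M = b * m) (hb : 2 ≤ b) {k : ℕ}
    (hk : m = k + k) (hk2 : 2 ≤ k) {lam : ℝ} (hlam : 0 < lam) (hlam1 : lam < 1) :
    ¬ IsNegDefKernel (fun x y : TorusSite 2 M => -Real.log (∑ x' : TorusSite 2 M, ∑ y' : TorusSite 2 M,
        if (∀ i : Fin 2, (x' i).val / b = (x i).val / b) ∧ (∀ i : Fin 2, (y' i).val / b = (y i).val / b)
        then lam ^ (∑ i : Fin 2, min (x' i - y' i).val (M - (x' i - y' i).val)) else 0)) := by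
  have hT : ∀ v x y : TorusSite 2 M,
      lam ^ (∑ i : Fin 2, min ((x + v) i - (y + v) i).val (M - ((x + v) i - (y + v) i).val)) =
        lam ^ (∑ i : Fin 2, min (x i - y i).val (M - (x i - y i).val)) := fun v x y => by
    simp only [Pi.add_apply, add_sub_add_right_eq_sub]
  have hS : ∀ x y : TorusSite 2 M,
      lam ^ (∑ i : Fin 2, min (x i - y i).val (M - (x i - y i).val)) =
        lam ^ (∑ i : Fin 2, min (y i - x i).val (M - (y i - x i).val)) := fun x y => by
    congr 1
    refine Finset.sum_congr rfl fun i _ => ?_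
    rw [← cyclicDist_neg (x i - y i), neg_sub]
  rw [isNegDefKernel_negLog_blockKernel_iff hM
    (fun x y : TorusSite 2 M => lam ^ (∑ i : Fin 2, min (x i - y i).val (M - (x i - y i).val))) hT hS]
  intro h
  have hneg := expKernel_blockLevyCoeff_neg hM hb hk hk2 hlam hlam1
  have hq : (Pi.single 0 (2 : ZMod m) : TorusSite 2 m) ≠ 0 := by
    intro h0
    have h2 : (2 : ZMod m) = 0 := by
      have := congrFun h0 0
      simpa using this
    have h' : ((2 : ℕ) : ZMod m) = 0 := by exact_mod_cast h2
    rw [ZMod.natCast_eq_zero_iff] at h'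
    have := Nat.le_of_dvd (by norm_num) h'
    omega
  exact absurd (h _ hq) (not_le.mpr hneg)

end Planar

end TorusBlock

end Literature.Probability.LatticeModels

end
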